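import Literature.Probability.LatticeModels.FlatBoundaryLatticeWindow
import Literature.Probability.LatticeModels.LatticeOrientFrame
import Literature.Probability.LatticeModels.BoundaryPoleGreenBounds
import Literature.Probability.RandomPlanarGeometry.RectilinearJordanLocalStructure
import HarnessLib

/-!
# The lattice window at a flat boundary point, in the straightening frame

Topic `Literature/Probability/LatticeModels` (bookkeeping for the proof of D. Chelkak, S. Smirnov,
Adv. Math. 228 (2011), Thm. 3.13, tree fact `ChelkakSmirnov2011_boundaryNormalisedPoissonKernelLimit`;
continues `FlatBoundaryLatticeWindow.lean` and `LatticeOrientFrame.lean`).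

A flat boundary point `x` of a Jordan domain `D` (all boundary points within `r` of `x` on the
horizontal, or on the vertical, line through `x`) has an orientation `o : Orient` such that inside
`B(x, r)` membership in `D̄` (resp. `D`) is `nrmC o x ≤ nrmC o z` (resp. `<`)
(`exists_orient_of_flat`, from `JordanDomain.halfDisc_structure_of_flat_im/re`). In the frame
`σ = Orient.frame o` the four window lemmas of `FlatBoundaryLatticeWindow.lean` become the single
"domain above" statement for the mapped set `V.map σ` at the mapped pole `σ b` (`window_frame`).
Consequences used by the assembly: the window Finset and the normalisation rectangle lie in the
mapped set (`windowFinset_subset_of_window`, `rectInterior_subset_of_window`), the pole has an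
outside neighbour at mesh distance `δ` (`exists_not_mem_norm_sub_le`), and the a priori upper
bound `G_V(b, z) ≤ C/ρ` away from the pole holds in every orientation
(`dirichletGreen_le_flatPoleConst_div_frame`, by `dirichletGreen_map_motion`).

Everything is proved, [folklore].
-/

noncomputable section

namespace Literature.Probability.LatticeModels

open _root_.Complex Metric Set Orient WeakBeurling
open Literature.Probability.RandomPlanarGeometry

/-! ### Orientation of a flat boundary point -/

/-- **Orientation at a flat boundary point.** If all boundary points of the Jordan domain `D`
within `r` of the boundary point `x` lie on the horizontal (or all on the vertical) line through
`x`, then for some orientation `o`, inside `B(x,r)`: `z ∈ D̄ ↔ nrmC o x ≤ nrmC o z` and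
`z ∈ D ↔ nrmC o x < nrmC o z`. [folklore] -/
theorem exists_orient_of_flat (D : JordanDomain) {x : ℂ} (hx : x ∈ frontier D.carrier) {r : ℝ} (hr : 0 < r)
    (hflat : (∀ z ∈ frontier D.carrier, dist z x < r → z.im = x.im) ∨
      (∀ z ∈ frontier D.carrier, dist z x < r → z.re = x.re)) :
    ∃ o : Orient, (∀ z, dist z x < r → (z ∈ closure D.carrier ↔ nrmC o x ≤ nrmC o z)) ∧
      (∀ z, dist z x < r → (z ∈ D.carrier ↔ nrmC o x < nrmC o z)) := by
  rcases hflat with hflat | hflat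
  · rcases D.halfDisc_structure_of_flat_im hx hr hflat with ⟨h1, h2⟩ | ⟨h1, h2⟩
    · exact ⟨up, fun z hz => by simpa [nrmC] using h1 z hz, fun z hz => by simpa [nrmC] using h2 z hz⟩
    · exact ⟨down, fun z hz => by simpa [nrmC] using h1 z hz, fun z hz => by simpa [nrmC] using h2 z hz⟩
  · rcases D.halfDisc_structure_of_flat_re hx hr hflat with ⟨h1, h2⟩ | ⟨h1, h2⟩
    · exact ⟨right, fun z hz => by simpa [nrmC] using h1 z hz, fun z hz => by simpa [nrmC] using h2 z hz⟩
    · exact ⟨left, fun z hz => by simpa [nrmC] using h1 z hz, fun z hz => by simpa [nrmC] using h2 z hz⟩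

/-! ### The window in the frame -/

variable {δ : ℝ} {V : Finset (Site 2)} {D : Set ℂ} {y : ℂ} {r : ℝ}

/-- **The lattice window in the straightening frame.** If inside `B(y, r)` membership in `D̄` is
`nrmC o y ≤ nrmC o z`, `V = {v : meshPoint δ v ∈ D̄}`, and `b ∈ V` has exactly one lattice
neighbour outside `V` with `dist(meshPoint δ b, y) + 2δ(W+1) < r`, then in the frame `σ = frame o`:
for all `z'` with `|z'₀ - (σb)₀| ≤ W`, `|z'₁ - (σb)₁| ≤ W`, `z' ∈ σ(V) ↔ (σb)₁ ≤ z'₁`. [folklore] -/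
theorem window_frame (o : Orient) (hδ : 0 < δ) (hV : ∀ v : Site 2, v ∈ V ↔ meshPoint δ v ∈ closure D)
    (hstruct : ∀ z, dist z y < r → (z ∈ closure D ↔ nrmC o y ≤ nrmC o z))
    {b : Site 2} (hbV : b ∈ V) (hb : (((zdGraph 2).neighborFinset b).filter (fun u => u ∉ V)).card = 1)
    {W : ℕ} (hbdist : dist (meshPoint δ b) y + 2 * δ * (W + 1) < r) :
    ∀ z' : Site 2, |z' 0 - frame o b 0| ≤ W → |z' 1 - frame o b 1| ≤ W →
      (z' ∈ V.map (frame o).toEmbedding ↔ frame o b 1 ≤ z' 1) := by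
  intro z' h0 h1
  set z := (frame o).symm z' with hz
  have hz' : z' = frame o z := by rw [hz, Equiv.apply_symm_apply]
  rw [hz'] at h0 h1 ⊢
  rw [Finset.mem_map_equiv, Equiv.symm_apply_apply]
  obtain ⟨h0', h1'⟩ := (abs_frame_sub_le_iff o z b W).1 ⟨h0, h1⟩
  cases o
  · have hs : ∀ p ∈ ball y r, p ∈ closure D ↔ y.im ≤ p.im := fun p hp => by
      simpa [nrmC] using hstruct p (mem_ball.1 hp)
    simpa [nrm] using window_of_oneSided_ge hδ hV hs hbV hb hbdist z h0' h1'
  · have hs : ∀ p ∈ ball y r, p ∈ closure D ↔ p.im ≤ y.im := fun p hp => by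
      simpa [nrmC] using hstruct p (mem_ball.1 hp)
    simpa [nrm] using window_of_oneSided_le hδ hV hs hbV hb hbdist z h0' h1'
  · have hs : ∀ p ∈ ball y r, p ∈ closure D ↔ y.re ≤ p.re := fun p hp => by
      simpa [nrmC] using hstruct p (mem_ball.1 hp)
    simpa [nrm] using windowV_of_oneSided_ge hδ hV hs hbV hb hbdist z h0' h1'
  · have hs : ∀ p ∈ ball y r, p ∈ closure D ↔ p.re ≤ y.re := fun p hp => by
      simpa [nrmC] using hstruct p (mem_ball.1 hp)
    simpa [nrm] using windowV_of_oneSided_le hδ hV hs hbV hb hbdist z h0' h1'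

/-- **The pole has an outside neighbour at mesh distance `δ`.** [folklore] -/
theorem exists_not_mem_norm_sub_le (hδ : 0 < δ) {b : Site 2}
    (hb : (((zdGraph 2).neighborFinset b).filter (fun u => u ∉ V)).card = 1) :
    ∃ u : Site 2, ‖meshPoint δ u - meshPoint δ b‖ ≤ δ ∧ u ∉ V := by
  obtain ⟨u, hu⟩ := Finset.card_pos.1 (by rw [hb]; exact one_pos)
  rw [Finset.mem_filter, SimpleGraph.mem_neighborFinset] at hu
  obtain ⟨k, rfl⟩ := exists_eq_add_cornerUnit_of_adj hu.1
  refine ⟨_, ?_, hu.2⟩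
  rw [← dist_eq_norm, dist_meshPoint_add_cornerUnit hδ]

/-! ### Sets inside the window -/

variable {Λ : Finset (Site 2)} {b : Site 2}

/-- **The window Finset lies in the set** (`hsub` of `dirichletGreen_chain_ge`). [folklore] -/
theorem windowFinset_subset_of_window {W : ℕ}
    (hwin : ∀ z : Site 2, |z 0 - b 0| ≤ W → |z 1 - b 1| ≤ W → (z ∈ Λ ↔ b 1 ≤ z 1)) :
    windowFinset b W ⊆ Λ := by
  intro z hz
  rw [mem_windowFinset_iff] at hz
  obtain ⟨h0, h1, h2⟩ := hz
  exact (hwin z h0.le (by rw [abs_le]; constructor <;> omega)).2 h1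

/-- **The normalisation rectangle lies in the set and avoids a far pole**: with
`α = ((b)₀ - S, (b)₁ - 1)` at the window centre `b` (here: the normalisation point), the rectangle
`rectInterior α (2S) T` lies in `Λ ∖ {p}` when `S ≤ W`, `T ≤ W + 2` and `p` is far
(`S < |p₀ - b₀|` or `T < |p₁ - b₁| + 2` … stated as `S ≤ |p₀ - b₀| ∨ T - 1 ≤ |p₁ - b₁|` with `p₁ ≥ b₁`
failing). [folklore] -/
theorem rectInterior_subset_of_window {W S T : ℕ}
    (hwin : ∀ z : Site 2, |z 0 - b 0| ≤ W → |z 1 - b 1| ≤ W → (z ∈ Λ ↔ b 1 ≤ z 1))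
    (hS : S ≤ W) (hT : T ≤ W + 2) {p : Site 2}
    (hfar : (S : ℤ) ≤ |p 0 - b 0| ∨ (T : ℤ) ≤ |p 1 - b 1| + 1) {α : Site 2}
    (hα0 : α 0 = b 0 - S) (hα1 : α 1 = b 1 - 1) :
    rectInterior α (2 * S) T ⊆ (↑Λ : Set (Site 2)) \ {p} := by
  intro z hz
  simp only [rectInterior, mem_setOf_eq, hα0, hα1] at hz
  obtain ⟨h0, h0', h1, h1'⟩ := hz
  push_cast at h0' h1'
  refine ⟨Finset.mem_coe.2 ((hwin z ?_ ?_).2 (by omega)), ?_⟩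
  · rw [abs_le]; constructor <;> omega
  · rw [abs_le]; constructor <;> omega
  · rintro rfl
    rcases hfar with h | h
    · rw [le_abs] at h; omega
    · rw [abs_of_nonneg (by omega)] at h; omega

/-! ### The a priori upper bound in every orientation -/

/-- **`G_V(b, z) ≤ C/ρ` away from a flat pole, any orientation**: the window property in the frame
of `o` (width `W ≥ 8ρ`) gives `dirichletGreen V b z ≤ flatPoleConst/ρ` for `z ∈ V` at sup-distance
`≥ ρ ≥ 2` from `b` (`dirichletGreen_le_flatPoleConst_div` for `V.map σ`, transported back by
`dirichletGreen_map_motion`). [folklore] -/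
theorem dirichletGreen_le_flatPoleConst_div_frame (o : Orient) {ρ W : ℕ} (hρ : 2 ≤ ρ) (hWρ : 8 * ρ ≤ W)
    (hwin : ∀ z' : Site 2, |z' 0 - frame o b 0| ≤ W → |z' 1 - frame o b 1| ≤ W →
      (z' ∈ V.map (frame o).toEmbedding ↔ frame o b 1 ≤ z' 1))
    {z : Site 2} (hz : z ∈ V) (hfar : (ρ : ℤ) ≤ |z 0 - b 0| ∨ (ρ : ℤ) ≤ |z 1 - b 1|) :
    dirichletGreen V b z ≤ flatPoleConst / ρ := by
  rw [← dirichletGreen_map_motion (frame o) (isLatticeMotion_frame o) V b z]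
  refine dirichletGreen_le_flatPoleConst_div hρ hWρ hwin ((Finset.mem_map_equiv).2 (by simpa using hz)) ?_
  have hperm := abs_tng_abs_nrm o (z - b)
  simp only [tng_sub, nrm_sub, Pi.sub_apply] at hperm
  rw [frame_apply_zero, frame_apply_zero, frame_apply_one, frame_apply_one]
  rcases hperm with ⟨ht, hn⟩ | ⟨ht, hn⟩
  · rw [ht, hn]; exact hfar
  · rw [ht, hn]; exact hfar.symm

/-- **Symmetric form**: `G_V(z, b) ≤ C/ρ`. [folklore] -/
theorem dirichletGreen_le_flatPoleConst_div_frame' (o : Orient) {ρ W : ℕ} (hρ : 2 ≤ ρ) (hWρ : 8 * ρ ≤ W)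
    (hwin : ∀ z' : Site 2, |z' 0 - frame o b 0| ≤ W → |z' 1 - frame o b 1| ≤ W →
      (z' ∈ V.map (frame o).toEmbedding ↔ frame o b 1 ≤ z' 1))
    {z : Site 2} (hz : z ∈ V) (hfar : (ρ : ℤ) ≤ |z 0 - b 0| ∨ (ρ : ℤ) ≤ |z 1 - b 1|) :
    dirichletGreen V z b ≤ flatPoleConst / ρ := by
  rw [dirichletGreen_comm]; exact dirichletGreen_le_flatPoleConst_div_frame o hρ hWρ hwin hz hfar

/-- **Harmonicity in the frame**: `G_{σV}(σb, ·)` is lattice-harmonic on `σV ∖ {σb}`. [folklore] -/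
theorem isLatticeHarmonicOn_dirichletGreen_map (o : Orient) (V : Finset (Site 2)) (b : Site 2) :
    IsLatticeHarmonicOn (dirichletGreen (V.map (frame o).toEmbedding) (frame o b))
      ((↑(V.map (frame o).toEmbedding) : Set (Site 2)) \ {frame o b}) :=
  isLatticeHarmonicOn_dirichletGreen _ _

/-- **Values in the frame**: `G_{σV}(σb, z') = G_V(b, σ⁻¹ z')`. [folklore] -/
theorem dirichletGreen_map_frame (o : Orient) (V : Finset (Site 2)) (b z' : Site 2) :
    dirichletGreen (V.map (frame o).toEmbedding) (frame o b) z' = dirichletGreen V b ((frame o).symm z') := by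
  conv_lhs => rw [← (frame o).apply_symm_apply z']
  exact dirichletGreen_map_motion (frame o) (isLatticeMotion_frame o) V b _

end Literature.Probability.LatticeModels
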